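import Summits.CriticalPhenomena.SAWScalingLimit.Theorems.SAWDefectDecoherenceBoundaryClosureRCornerStructure
import Summits.CriticalPhenomena.SAWScalingLimit.Theorems.SAWDefectDecoherenceBoundaryClosureRTransportWedge
import Summits.CriticalPhenomena.SAWScalingLimit.Theorems.SAWDefectDecoherenceBoundaryClosureRTransportFrame
import Mathlib.MeasureTheory.Function.Jacobian
import Literature.Analysis.Complex.LengthArea
import HarnessLib

/-!
# `BoundaryClosureR` (stmt-CriticalPhenomena-14004), line `polygon-parity-squeeze`, stub
# `transportRigidity` (E), part F5a: the transported data at a corner image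

Hypothesis `hcorner` of `realLine_rigidity` for the transported observable
`K = (g · e^{-(5/8)(L - L_b)}) ∘ Φ⁻¹` and boundary measure `ν = (re Φ*)_* (c₀ wt μ|_G)` at the image
`x = Φ*(c)` of a genuine lattice corner `c` (opening `θπ`, `θ ∈ {1/3, 2/3, 4/3, 5/3}`): with
`γ = max 0 ((θ-1)·11/8) ≤ 11/12` and `β = max 0 ((θ-1)·3/8) ≤ 1/4`,
`|w - x|^γ ‖K w‖ ∈ L¹(B(x, r) ∩ ℍ)` and `∫_{(x-r,x+r)} |t - x|^β dν < ∞`.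
By the Schwarz–Christoffel structure (`cornerStructure`): `|Φ'| = |u₁| |z-c|^{1/θ-1}` and
`|Φ - x| = |u| |z-c|^{1/θ}` with `u, u₁` continuous zero-free on the closed wedge, so after the
change of variables `w = Φ z` the area weight `|Φ - x|^γ |Φ'|^{11/8}` and the boundary weight
`|Φ* - x|^β wt` (`wt = lim |Φ'|^{3/8}`) are BOUNDED near `c` (the exponents of `|z - c|` are
`≥ 0` by the choice of `γ, β`); integrability of `g` and finiteness of `μ` near `c` conclude.

References: Pommerenke, *Boundary Behaviour of Conformal Maps* (1992), Thm. 3.9.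
-/

noncomputable section

open scoped Topology ComplexConjugate ENNReal
open Filter Set Metric Complex MeasureTheory
open UpperHalfPlane (upperHalfPlaneSet)
open Literature.Probability.RandomPlanarGeometry

namespace Summit.CriticalPhenomena.SAWScalingLimit.Theorems.PolygonParitySqueeze

namespace Transport

/-! ### 1. Real-power bookkeeping -/

/-- `‖exp (a · log s)‖ = ‖s‖^a` for real `a` and `s ≠ 0`. [folklore] -/
theorem norm_exp_ofReal_mul_log {s : ℂ} (hs : s ≠ 0) (a : ℝ) :
    ‖Complex.exp ((a : ℂ) * Complex.log s)‖ = ‖s‖ ^ a := by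
  rw [Complex.norm_exp, re_ofReal_mul, Complex.log_re, Real.rpow_def_of_pos (norm_pos_iff.2 hs),
    mul_comm]

/-- The weight inequality: for `0 ≤ A ≤ CA`, `0 ≤ B ≤ CB`, `0 < ρ ≤ 1`, `0 ≤ a, b` and
`p a + p' b ≥ 0`: `(A ρ^p)^a (B ρ^{p'})^b ≤ CA^a CB^b`. [folklore] -/
theorem weight_le {A B CA CB ρ p p' a b : ℝ} (hA : 0 ≤ A) (hAC : A ≤ CA) (hB : 0 ≤ B)
    (hBC : B ≤ CB) (hρ : 0 < ρ) (hρ1 : ρ ≤ 1) (ha : 0 ≤ a) (hb : 0 ≤ b) (he : 0 ≤ p * a + p' * b) :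
    (A * ρ ^ p) ^ a * (B * ρ ^ p') ^ b ≤ CA ^ a * CB ^ b := by
  have hρp : ∀ t : ℝ, 0 ≤ ρ ^ t := fun t => (Real.rpow_pos_of_pos hρ t).le
  rw [Real.mul_rpow hA (hρp p), Real.mul_rpow hB (hρp p'), ← Real.rpow_mul hρ.le,
    ← Real.rpow_mul hρ.le]
  have h1 : ρ ^ (p * a) * ρ ^ (p' * b) ≤ 1 := by
    rw [← Real.rpow_add hρ]; exact Real.rpow_le_one hρ.le hρ1 he
  have h2 : A ^ a ≤ CA ^ a := Real.rpow_le_rpow hA hAC ha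
  have h3 : B ^ b ≤ CB ^ b := Real.rpow_le_rpow hB hBC hb
  calc A ^ a * ρ ^ (p * a) * (B ^ b * ρ ^ (p' * b)) = A ^ a * B ^ b * (ρ ^ (p * a) * ρ ^ (p' * b)) := by
        ring
    _ ≤ CA ^ a * CB ^ b * 1 := by
        apply mul_le_mul (mul_le_mul h2 h3 (Real.rpow_nonneg hB _) ((Real.rpow_nonneg hA _).trans h2))
          h1 (mul_nonneg (hρp _) (hρp _))
        exact mul_nonneg ((Real.rpow_nonneg hA _).trans h2) ((Real.rpow_nonneg hB _).trans h3)
    _ = CA ^ a * CB ^ b := mul_one _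

/-! ### 2. The corner bounds -/

/-- **The transported data at a corner image** (hypothesis `hcorner` of `realLine_rigidity`):
see the module docstring. [cite: PommerenkeBBCM1992, Thm. 3.9] -/
theorem corner_bounds (D : DobrushinDomain) (Φ : ConformalEquiv D.carrier upperHalfPlaneSet)
    (hΦ0 : Tendsto (fun z => ‖Φ z‖) (𝓝[D.carrier] (D.pt 0)) atTop)
    {Φs : ℂ → ℂ} (hΦsc : ContinuousOn Φs (closure D.carrier \ {D.pt 0}))
    (hΦse : EqOn Φs Φ D.carrier) (hΦsr : ∀ p ∈ frontier D.carrier, (Φs p).im = 0)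
    (hΦsi : InjOn Φs (closure D.carrier \ {D.pt 0}))
    {L : ℂ → ℂ} {Lb : ℂ} (hL : ContinuousOn L D.carrier)
    (hexp : ∀ z ∈ D.carrier, Complex.exp (L z) = deriv Φ z)
    {g : ℂ → ℂ} (hgi : ∀ K : Set ℂ, IsCompact K → IntegrableOn g (K ∩ D.carrier))
    {μ : Measure ℂ} (hμK : ∀ K : Set ℂ, IsCompact K → D.pt 0 ∉ K → μ K < ⊤)
    {Gs : Set ℂ} (hGm : MeasurableSet Gs) (hGsub : Gs ⊆ frontier D.carrier \ {D.pt 0})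
    {wt : ℂ → ℝ}
    (hwt : ∀ z, wt z = Real.exp ((3 / 8 : ℝ) * limUnder (𝓝[D.carrier] z) (fun w => (L w).re)))
    (hwtm : AEMeasurable wt (μ.restrict Gs))
    (hΦrm : AEMeasurable (fun z => (Φs z).re) (μ.restrict Gs))
    {c₀ : ℝ} (hc₀ : 0 < c₀) {ν : Measure ℝ}
    (hν : ν = Measure.map (fun z => (Φs z).re)
      ((μ.restrict Gs).withDensity fun z => ENNReal.ofReal (c₀ * wt z)))
    {K : ℂ → ℂ}
    (hK : ∀ w : ℂ, 0 < w.im → K w = g (Φ.symm w) * Complex.exp (-(5 / 8 : ℂ) * (L (Φ.symm w) - Lb)))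
    {c : ℂ} (hc : c ∈ frontier D.carrier) (hcG : c ∉ Gs) {k k' : Fin 6}
    (hk : innerNormal k' ≠ innerNormal k) (hk' : innerNormal k' ≠ -innerNormal k) {s : ℝ} (hs : 0 < s)
    (hset : D.carrier ∩ ball c s = halfPlane k c ∩ halfPlane k' c ∩ ball c s ∨
      D.carrier ∩ ball c s = (halfPlane k c ∪ halfPlane k' c) ∩ ball c s)
    (h0 : D.pt 0 ∉ closedBall c s) :
    ∃ (r γ β : ℝ), 0 < r ∧ 0 ≤ γ ∧ γ < 1 ∧ 0 ≤ β ∧ β < 1 ∧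
      IntegrableOn (fun w : ℂ => (‖w - (((Φs c).re : ℝ) : ℂ)‖ ^ γ : ℝ) * ‖K w‖)
        (ball (((Φs c).re : ℝ) : ℂ) r ∩ {w : ℂ | 0 < w.im}) ∧
      ∫⁻ t in Ioo ((Φs c).re - r) ((Φs c).re + r), ENNReal.ofReal (|t - (Φs c).re| ^ β) ∂ν < ⊤ := by
  have hU : IsOpen D.carrier := D.isOpen
  have hccl : c ∈ closure D.carrier := frontier_subset_closure hc
  have hc0 : c ≠ D.pt 0 := fun h => h0 (h ▸ mem_closedBall_self hs.le)
  set x : ℝ := (Φs c).re with hx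
  have hxc : ((x : ℝ) : ℂ) = Φs c := Complex.ext (by simp [hx]) (by simp [hΦsr c hc])
  -- Step 1: the corner is a wedge of opening `θπ`, `0 < θ ≤ 5/3`
  set n : ℂ := innerNormal k
  set n' : ℂ := innerNormal k'
  obtain ⟨ψ, θ₀, hθ₀13, hθ₀1, hWI, hWU⟩ := halfPlanes_eq_wedge (norm_innerNormal k) (norm_innerNormal k')
    hk hk' (innerNormal_re_mul_conj k k' hk hk') c
  obtain ⟨θ, hθ0, hθ53, hW⟩ : ∃ θ : ℝ, 0 < θ ∧ θ ≤ 5 / 3 ∧ D.carrier ∩ ball c s =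
      {z : ℂ | z ≠ c ∧ |arg ((z - c) * Complex.exp (-(ψ : ℂ) * I))| < θ * Real.pi / 2} ∩ ball c s := by
    rcases hset with h | h
    · exact ⟨θ₀, by linarith, by linarith, by rw [h]; exact congrArg (· ∩ ball c s) hWI⟩
    · exact ⟨2 - θ₀, by linarith, by linarith, by rw [h]; exact congrArg (· ∩ ball c s) hWU⟩
  have hθ2 : θ < 2 := by linarith
  -- Step 2: the corner structure on `B(c, r₁)`, `r₁ = min s 1`
  set r₁ : ℝ := min s 1 with hr₁
  have hr₁0 : 0 < r₁ := lt_min hs one_pos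
  have hr₁s : ball c r₁ ⊆ ball c s := ball_subset_ball (min_le_left _ _)
  have hW₁ : D.carrier ∩ ball c r₁ =
      {z : ℂ | z ≠ c ∧ |arg ((z - c) * Complex.exp (-(ψ : ℂ) * I))| < θ * Real.pi / 2} ∩ ball c r₁ := by
    rw [← inter_eq_self_of_subset_right hr₁s, ← inter_assoc, hW, inter_assoc,
      inter_eq_self_of_subset_right hr₁s]
  have hsub0 : closure D.carrier ∩ ball c r₁ ⊆ closure D.carrier \ {D.pt 0} := fun w hw =>
    ⟨hw.1, fun h => h0 (ball_subset_closedBall (hr₁s (mem_singleton_iff.1 h ▸ hw.2)))⟩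
  obtain ⟨r', u, u₁, hr'0, hr'r₁, huc, hu₁c, hne, hval, hder⟩ := cornerStructure D.carrier c ψ θ r₁ hU
    hθ0 hθ2 hr₁0 hW₁ Φ Φs Φ.differentiableOn Φ.injOn (fun z hz => Φ.mapsTo hz) (hΦsc.mono hsub0)
    (hΦse.mono inter_subset_left) (fun z hz => hΦsr z hz.1)
  have hr'1 : r' ≤ 1 := hr'r₁.trans (min_le_right _ _)
  have hr's : r' ≤ s := hr'r₁.trans (min_le_left _ _)
  -- bounds for `u`, `u₁` on the compact `closure Ω ∩ closedBall c (r'/2)`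
  have hcb : closedBall c (r' / 2) ⊆ ball c r' := closedBall_subset_ball (by linarith)
  have hcpt : IsCompact (closure D.carrier ∩ closedBall c (r' / 2)) :=
    (isCompact_closedBall c (r' / 2)).inter_left isClosed_closure
  obtain ⟨Cu, hCu⟩ := hcpt.exists_bound_of_continuousOn (huc.mono fun z hz => ⟨hz.1, hcb hz.2⟩)
  obtain ⟨Cu₁, hCu₁⟩ := hcpt.exists_bound_of_continuousOn (hu₁c.mono fun z hz => ⟨hz.1, hcb hz.2⟩)
  -- the two norm identities on `Ω ∩ B(c, r')`
  set q : ℝ := 1 / θ - 1 with hq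
  have hsv : ∀ z, ‖(z - c) * Complex.exp (-(ψ : ℂ) * I)‖ = ‖z - c‖ := fun z => by
    rw [norm_mul, show -(ψ : ℂ) * I = ((-ψ : ℝ) : ℂ) * I by push_cast; ring, norm_exp_ofReal_mul_I,
      mul_one]
  have hcΩ : c ∉ D.carrier := fun h => by
    have := hc; rw [frontier, hU.interior_eq] at this; exact this.2 h
  have hzc : ∀ z ∈ D.carrier, z - c ≠ 0 := fun z hz h => hcΩ (sub_eq_zero.1 h ▸ hz)
  have hnder : ∀ z ∈ D.carrier ∩ ball c r', ‖deriv Φ z‖ = ‖u₁ z‖ * ‖z - c‖ ^ q := by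
    intro z hz
    rw [hder z hz, norm_mul, norm_exp_ofReal_mul_log (mul_ne_zero (hzc z hz.1) (Complex.exp_ne_zero _)),
      hsv]
  have hnval : ∀ z ∈ D.carrier ∩ ball c r', ‖Φ z - Φs c‖ = ‖u z‖ * ‖z - c‖ ^ (1 / θ) := by
    intro z hz
    rw [hval z hz, norm_mul, norm_exp_ofReal_mul_log (mul_ne_zero (hzc z hz.1) (Complex.exp_ne_zero _)),
      hsv]
  -- Step 3: the exponents
  set γ : ℝ := max 0 ((θ - 1) * (11 / 8)) with hγ
  set β : ℝ := max 0 ((θ - 1) * (3 / 8)) with hβ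
  have hγ0 : 0 ≤ γ := le_max_left _ _
  have hβ0 : 0 ≤ β := le_max_left _ _
  have hγ1 : γ < 1 := max_lt (by norm_num) (by nlinarith)
  have hβ1 : β < 1 := max_lt (by norm_num) (by nlinarith)
  have hea : 0 ≤ q * (11 / 8) + 1 / θ * γ := by
    have h1 : (θ - 1) * (11 / 8) ≤ γ := le_max_right _ _
    have : q * (11 / 8) + 1 / θ * γ = ((1 - θ) * (11 / 8) + γ) / θ := by
      simp only [hq]; field_simp
    rw [this]; exact div_nonneg (by linarith) hθ0.le
  have heb : 0 ≤ q * (3 / 8) + 1 / θ * β := by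
    have h1 : (θ - 1) * (3 / 8) ≤ β := le_max_right _ _
    have : q * (3 / 8) + 1 / θ * β = ((1 - θ) * (3 / 8) + β) / θ := by
      simp only [hq]; field_simp
    rw [this]; exact div_nonneg (by linarith) hθ0.le
  -- Step 4: localisation `‖Φ* z - Φ* c‖ < r ⇒ dist z c < r'/2`
  obtain ⟨r, hr0, hloc⟩ := frameExt_localise hΦ0 hΦsc hΦse hΦsi hccl hc0 (half_pos hr'0)
  have h0B : D.pt 0 ∉ closedBall c (r' / 2) := fun h => h0 (closedBall_subset_closedBall (by linarith) h)
  refine ⟨r, γ, β, hr0, hγ0, hγ1, hβ0, hβ1, ?_, ?_⟩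
  · -- Step 5: the area bound
    set S : Set ℂ := D.carrier ∩ (Φ : ℂ → ℂ) ⁻¹' ball ((x : ℝ) : ℂ) r with hS
    have hSo : IsOpen S := Φ.continuousOn.isOpen_inter_preimage hU isOpen_ball
    have hSm : MeasurableSet S := hSo.measurableSet
    have hSc : S ⊆ D.carrier ∩ ball c (r' / 2) := fun z hz => ⟨hz.1, mem_ball.2 (hloc z
      (subset_closure hz.1) (fun h => hcΩ ?_) (by
        have := mem_ball.1 hz.2; rwa [dist_eq_norm, hxc, ← hΦse hz.1] at this))⟩
    swap; · exact absurd hz.1 (h ▸ fun h' => by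
        have := D.pt_mem_frontier 0; rw [frontier, hU.interior_eq] at this; exact this.2 h')
    have hSimg : (Φ : ℂ → ℂ) '' S = ball ((x : ℝ) : ℂ) r ∩ {w : ℂ | 0 < w.im} := by
      apply Subset.antisymm
      · rintro _ ⟨z, hz, rfl⟩; exact ⟨hz.2, Φ.mapsTo hz.1⟩
      · rintro w ⟨hw, hwim⟩
        exact ⟨Φ.symm w, ⟨Φ.symm_mapsTo hwim, by simpa [Φ.apply_symm_apply hwim] using hw⟩,
          Φ.apply_symm_apply hwim⟩
    have hd : ∀ z ∈ S, HasFDerivWithinAt (Φ : ℂ → ℂ)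
        ((ContinuousLinearMap.smulRight (1 : ℂ →L[ℂ] ℂ) (deriv Φ z)).restrictScalars ℝ) S z :=
      fun z hz => ((Φ.differentiableOn.differentiableAt (hU.mem_nhds hz.1)).hasDerivAt.hasFDerivAt
        |>.restrictScalars ℝ).hasFDerivWithinAt
    rw [← hSimg]
    refine (integrableOn_image_iff_integrableOn_abs_det_fderiv_smul volume hSm hd
      (Φ.injOn.mono fun z hz => hz.1) _).2 ?_
    set W : ℂ → ℝ := fun z => ‖deriv Φ z‖ ^ 2 * (‖Φ z - ((x : ℝ) : ℂ)‖ ^ γ *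
      Real.exp (-(5 / 8 : ℝ) * ((L z).re - Lb.re))) with hWdef
    have hΦ'c : ContinuousOn (deriv (Φ : ℂ → ℂ)) D.carrier :=
      ((Φ.differentiableOn.analyticOnNhd hU).deriv).continuousOn
    have hWc : ContinuousOn W S := by
      refine ((hΦ'c.mono fun z hz => hz.1).norm.pow 2).mul (ContinuousOn.mul ?_ ?_)
      · exact ((Φ.continuousOn.mono fun z hz => hz.1).sub continuousOn_const).norm.rpow_const
          fun z _ => Or.inr hγ0
      · exact Real.continuous_exp.comp_continuousOn
          (((Complex.continuous_re.comp_continuousOn (hL.mono fun z hz => hz.1)).sub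
            continuousOn_const).const_smul (-(5 / 8 : ℝ)))
    set CW : ℝ := Real.exp ((5 / 8 : ℝ) * Lb.re) * (Cu₁ ^ (11 / 8 : ℝ) * Cu ^ γ) with hCW
    have hWle : ∀ z ∈ S, ‖W z‖ ≤ CW := by
      intro z hz
      have hz' : z ∈ D.carrier ∩ ball c r' := ⟨hz.1, hcb (ball_subset_closedBall (hSc hz).2)⟩
      have hzcl : z ∈ closure D.carrier ∩ closedBall c (r' / 2) :=
        ⟨subset_closure hz.1, ball_subset_closedBall (hSc hz).2⟩
      have hρ : 0 < ‖z - c‖ := norm_pos_iff.2 (hzc z hz.1)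
      have hρ1 : ‖z - c‖ ≤ 1 := by
        have := mem_ball.1 hz'.2; rw [dist_eq_norm] at this; linarith
      have hE : Real.exp ((L z).re) = ‖deriv Φ z‖ := by rw [← Complex.norm_exp, hexp z hz.1]
      have hEpos : 0 < ‖deriv Φ z‖ := by rw [← hE]; exact Real.exp_pos _
      have hWz : W z = Real.exp ((5 / 8 : ℝ) * Lb.re) *
          ((‖u₁ z‖ * ‖z - c‖ ^ q) ^ (11 / 8 : ℝ) * (‖u z‖ * ‖z - c‖ ^ (1 / θ)) ^ γ) := by
        have h1 : Real.exp (-(5 / 8 : ℝ) * ((L z).re - Lb.re)) =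
            ‖deriv Φ z‖ ^ (-(5 / 8 : ℝ)) * Real.exp ((5 / 8 : ℝ) * Lb.re) := by
          rw [show -(5 / 8 : ℝ) * ((L z).re - Lb.re) = (L z).re * (-(5 / 8 : ℝ)) + (5 / 8 : ℝ) * Lb.re
            by ring, Real.exp_add, Real.exp_mul, hE]
        have h2 : ‖deriv Φ z‖ ^ 2 * ‖deriv Φ z‖ ^ (-(5 / 8 : ℝ)) = ‖deriv Φ z‖ ^ (11 / 8 : ℝ) := by
          rw [show (‖deriv Φ z‖ ^ 2 : ℝ) = ‖deriv Φ z‖ ^ (2 : ℝ) by norm_cast, ← Real.rpow_add hEpos]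
          norm_num
        simp only [hWdef]
        rw [h1, hxc, hnval z hz', show ‖deriv Φ z‖ ^ 2 * ((‖u z‖ * ‖z - c‖ ^ (1 / θ)) ^ γ *
            (‖deriv Φ z‖ ^ (-(5 / 8 : ℝ)) * Real.exp (5 / 8 * Lb.re))) =
            Real.exp (5 / 8 * Lb.re) * ((‖deriv Φ z‖ ^ 2 * ‖deriv Φ z‖ ^ (-(5 / 8 : ℝ))) *
            (‖u z‖ * ‖z - c‖ ^ (1 / θ)) ^ γ) by ring, h2, hnder z hz']
      rw [Real.norm_eq_abs, abs_of_nonneg (by simp only [hWdef]; positivity), hWz, hCW]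
      refine mul_le_mul_of_nonneg_left ?_ (Real.exp_pos _).le
      exact weight_le (norm_nonneg _) (hCu₁ z hzcl) (norm_nonneg _) (hCu z hzcl) hρ hρ1 (by norm_num)
        hγ0 hea
    have hgS : IntegrableOn g S :=
      (hgi _ (isCompact_closedBall c (r' / 2))).mono_set fun z hz => ⟨(hSc hz).2 |> ball_subset_closedBall, hz.1⟩
    have h1 : IntegrableOn (fun z => W z * ‖g z‖) S :=
      Integrable.bdd_mul (c := CW) hgS.norm (hWc.aestronglyMeasurable hSm)
        ((ae_restrict_iff' hSm).2 (Eventually.of_forall hWle))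
    refine h1.congr_fun (fun z hz => ?_) hSm
    have hzΩ : z ∈ D.carrier := hz.1
    rw [Literature.Analysis.Complex.LengthArea.det_restrictScalars_smulRight, abs_of_nonneg (by positivity),
      smul_eq_mul, hK _ (Φ.mapsTo hzΩ), Φ.symm_apply_apply hzΩ, norm_mul, Complex.norm_exp]
    simp only [hWdef]
    have : (-(5 / 8 : ℂ) * (L z - Lb)).re = -(5 / 8 : ℝ) * ((L z).re - Lb.re) := by
      simp [Complex.mul_re]
    rw [this]; ring
  · -- Step 6: the boundary moment
    have hΦr_w : AEMeasurable (fun z => (Φs z).re)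
        ((μ.restrict Gs).withDensity fun z => ENNReal.ofReal (c₀ * wt z)) :=
      hΦrm.mono_ac (withDensity_absolutelyContinuous _ _)
    have hdens : AEMeasurable (fun z => ENNReal.ofReal (c₀ * wt z)) (μ.restrict Gs) :=
      ENNReal.measurable_ofReal.comp_aemeasurable (hwtm.const_mul c₀)
    set f : ℝ → ℝ≥0∞ := fun t => ENNReal.ofReal (|t - x| ^ β) with hf
    have hfm : Measurable f :=
      ENNReal.measurable_ofReal.comp ((continuous_abs.comp (continuous_id.sub continuous_const)).measurable.pow_const β)
    set CB : ℝ := c₀ * (Cu₁ ^ (3 / 8 : ℝ) * Cu ^ β) with hCB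
    -- pointwise bound on the flat boundary part `Gs`
    have hbound : ∀ z ∈ Gs, ENNReal.ofReal (c₀ * wt z) * (Ioo (x - r) (x + r)).indicator f ((Φs z).re) ≤
        (closedBall c (r' / 2)).indicator (fun _ => ENNReal.ofReal CB) z := by
      intro z hzG
      by_cases hI : (Φs z).re ∈ Ioo (x - r) (x + r)
      · have hzf : z ∈ frontier D.carrier := (hGsub hzG).1
        have hz0 : z ≠ D.pt 0 := (hGsub hzG).2
        have hzcl0 : z ∈ closure D.carrier := frontier_subset_closure hzf
        have hzne : z ≠ c := fun h => hcG (h ▸ hzG)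
        have hzre : (((Φs z).re : ℝ) : ℂ) = Φs z := Complex.ext (by simp) (by simp [hΦsr z hzf])
        have habs : |(Φs z).re - x| < r := by
          rw [abs_sub_lt_iff]; constructor <;> linarith [hI.1, hI.2]
        have hnorm : ‖Φs z - Φs c‖ = |(Φs z).re - x| := by
          rw [show Φs z - Φs c = (((Φs z).re - x : ℝ) : ℂ) by rw [ofReal_sub, hzre, hxc], norm_real,
            Real.norm_eq_abs]
        have hdist : dist z c < r' / 2 := hloc z hzcl0 hz0 (by rw [hnorm]; exact habs)
        have hzb : z ∈ closedBall c (r' / 2) := ball_subset_closedBall (mem_ball.2 hdist)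
        have hzball : z ∈ ball c r' := hcb hzb
        have hzcl : z ∈ closure D.carrier ∩ closedBall c (r' / 2) := ⟨hzcl0, hzb⟩
        have hρ : 0 < ‖z - c‖ := norm_pos_iff.2 (sub_ne_zero.2 hzne)
        have hρ1 : ‖z - c‖ ≤ 1 := by
          have := mem_ball.1 hzball; rw [dist_eq_norm] at this; linarith
        have hu₁z : u₁ z ≠ 0 := (hne z ⟨hzcl0, hzball⟩).2
        rw [indicator_of_mem hI, indicator_of_mem hzb]
        -- the boundary modulus `wt z = (‖u₁ z‖ ‖z - c‖^q)^{3/8}`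
        have hwtz : wt z = (‖u₁ z‖ * ‖z - c‖ ^ q) ^ (3 / 8 : ℝ) := by
          set F : ℂ → ℝ := fun w => Real.log ‖u₁ w‖ + q * Real.log ‖w - c‖ with hF
          have hFc : ContinuousWithinAt F (closure D.carrier ∩ ball c r') z := by
            refine ContinuousWithinAt.add ?_ (ContinuousWithinAt.mul continuousWithinAt_const ?_)
            · exact (hu₁c z ⟨hzcl0, hzball⟩).norm.log (norm_ne_zero_iff.2 hu₁z)
            · exact (continuousWithinAt_id.sub continuousWithinAt_const).norm.log hρ.ne'
          have hT : Tendsto (fun w => (L w).re) (𝓝[D.carrier] z) (𝓝 (F z)) := by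
            have h1 : Tendsto F (𝓝[D.carrier ∩ ball c r'] z) (𝓝 (F z)) :=
              hFc.tendsto.mono_left (nhdsWithin_mono _ fun w hw => ⟨subset_closure hw.1, hw.2⟩)
            rw [nhdsWithin_inter_of_mem' (mem_nhdsWithin_of_mem_nhds (isOpen_ball.mem_nhds hzball))] at h1
            refine h1.congr' ?_
            filter_upwards [self_mem_nhdsWithin,
              mem_nhdsWithin_of_mem_nhds (isOpen_ball.mem_nhds hzball)] with w hw hwb
            have hE : Real.exp ((L w).re) = ‖deriv Φ w‖ := by rw [← Complex.norm_exp, hexp w hw]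
            have hwρ : 0 < ‖w - c‖ := norm_pos_iff.2 (hzc w hw)
            have hu₁w : 0 < ‖u₁ w‖ := norm_pos_iff.2 (hne w ⟨subset_closure hw, hwb⟩).2
            simp only [hF]
            rw [← Real.log_rpow hwρ, ← Real.log_mul hu₁w.ne' (Real.rpow_pos_of_pos hwρ _).ne',
              ← hnder w ⟨hw, hwb⟩, ← hE, Real.log_exp]
          haveI : NeBot (𝓝[D.carrier] z) := mem_closure_iff_nhdsWithin_neBot.1 hzcl0
          rw [hwt z, hT.limUnder_eq]
          simp only [hF]
          rw [← Real.log_rpow hρ, ← Real.log_mul (norm_ne_zero_iff.2 hu₁z) (Real.rpow_pos_of_pos hρ _).ne',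
            Real.rpow_def_of_pos (mul_pos (norm_pos_iff.2 hu₁z) (Real.rpow_pos_of_pos hρ _)), mul_comm]
        -- the boundary distance `|Φ* z - x| = ‖u z‖ ‖z - c‖^{1/θ}`
        have hdz : |(Φs z).re - x| = ‖u z‖ * ‖z - c‖ ^ (1 / θ) := by
          rw [← hnorm]
          have hA : D.carrier ∩ ball c r' ⊆ closure D.carrier \ {D.pt 0} := fun w hw =>
            ⟨subset_closure hw.1, fun h => h0 (closedBall_subset_closedBall hr's
              (ball_subset_closedBall (mem_singleton_iff.1 h ▸ hw.2)))⟩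
          have hzA : z ∈ closure (D.carrier ∩ ball c r') := by
            rw [inter_comm]; exact isOpen_ball.inter_closure ⟨hzball, hzcl0⟩
          haveI : NeBot (𝓝[D.carrier ∩ ball c r'] z) := mem_closure_iff_nhdsWithin_neBot.1 hzA
          have h1 : Tendsto (fun w => ‖Φs w - Φs c‖) (𝓝[D.carrier ∩ ball c r'] z) (𝓝 ‖Φs z - Φs c‖) :=
            (((hΦsc z ⟨hzcl0, fun h => hz0 h⟩).mono hA).sub continuousWithinAt_const).norm.tendsto
          have h2 : Tendsto (fun w => ‖u w‖ * ‖w - c‖ ^ (1 / θ)) (𝓝[D.carrier ∩ ball c r'] z)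
              (𝓝 (‖u z‖ * ‖z - c‖ ^ (1 / θ))) := by
            refine (((huc z ⟨hzcl0, hzball⟩).mono fun w hw => ⟨subset_closure hw.1, hw.2⟩).norm.mul
              ?_).tendsto
            exact ((continuousWithinAt_id.sub continuousWithinAt_const).norm.rpow_const
              (Or.inr (by positivity)))
          refine tendsto_nhds_unique (h1.congr' ?_) h2
          filter_upwards [self_mem_nhdsWithin] with w hw
          rw [hΦse hw.1, hnval w hw]
        -- assemble
        rw [← ENNReal.ofReal_mul (mul_nonneg hc₀.le (by rw [hwt z]; exact (Real.exp_pos _).le))]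
        refine ENNReal.ofReal_le_ofReal ?_
        rw [hwtz, hdz, hCB, mul_assoc]
        refine mul_le_mul_of_nonneg_left ?_ hc₀.le
        exact weight_le (norm_nonneg _) (hCu₁ z hzcl) (norm_nonneg _) (hCu z hzcl) hρ hρ1 (by norm_num)
          hβ0 heb
      · rw [indicator_of_notMem hI, mul_zero]; exact bot_le
    -- the integral
    have hgm : AEMeasurable (fun z => (Ioo (x - r) (x + r)).indicator f ((Φs z).re)) (μ.restrict Gs) :=
      (hfm.indicator measurableSet_Ioo).comp_aemeasurable hΦrm
    rw [hν, ← lintegral_indicator measurableSet_Ioo,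
      lintegral_map' ((hfm.indicator measurableSet_Ioo).aemeasurable) hΦr_w,
      lintegral_withDensity_eq_lintegral_mul₀ hdens hgm]
    calc ∫⁻ z, ((fun z => ENNReal.ofReal (c₀ * wt z)) * fun z =>
          (Ioo (x - r) (x + r)).indicator f ((Φs z).re)) z ∂(μ.restrict Gs)
        ≤ ∫⁻ z, (closedBall c (r' / 2)).indicator (fun _ => ENNReal.ofReal CB) z ∂(μ.restrict Gs) := by
          refine lintegral_mono_ae ?_
          filter_upwards [ae_restrict_mem hGm] with z hz
          exact hbound z hz
      _ = ENNReal.ofReal CB * (μ.restrict Gs) (closedBall c (r' / 2)) :=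
          lintegral_indicator_const measurableSet_closedBall _
      _ ≤ ENNReal.ofReal CB * μ (closedBall c (r' / 2)) :=
          mul_le_mul_right (Measure.restrict_apply_le _ _) _
      _ < ⊤ := ENNReal.mul_lt_top ENNReal.ofReal_lt_top (hμK _ (isCompact_closedBall _ _) h0B)

/-! ### 3. Registered form -/

/-- **Registered helper `transport_cornerBounds`** (∀-closed form of `corner_bounds`; sub-goal F5a of
stub `transportRigidity` (E), crux stmt-CriticalPhenomena-14004, line `polygon-parity-squeeze`).
[cite: PommerenkeBBCM1992, Thm. 3.9] -/
theorem transport_cornerBounds : ∀ (D : DobrushinDomain) (Φ : ConformalEquiv D.carrier UpperHalfPlane.upperHalfPlaneSet) (Φs L : ℂ → ℂ) (Lb : ℂ) (g : ℂ → ℂ) (μ : MeasureTheory.Measure ℂ) (Gs : Set ℂ) (wt : ℂ → ℝ) (c₀ : ℝ) (ν : MeasureTheory.Measure ℝ) (K : ℂ → ℂ) (c : ℂ) (k k' : Fin 6) (s : ℝ), Filter.Tendsto (fun z => ‖Φ z‖) (𝓝[D.carrier] (D.pt 0)) Filter.atTop → ContinuousOn Φs (closure D.carrier \ {D.pt 0})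 → Set.EqOn Φs Φ D.carrier → (∀ p ∈ frontier D.carrier, (Φs p).im = 0) → Set.InjOn Φs (closure D.carrier \ {D.pt 0}) → ContinuousOn L D.carrier → (∀ z ∈ D.carrier, Complex.exp (L z) = deriv Φ z) → (∀ K' : Set ℂ, IsCompact K' → MeasureTheory.IntegrableOn g (K' ∩ D.carrier)) → (∀ K' : Set ℂ, IsCompact K' → D.pt 0 ∉ K' → μ K' < ⊤) → MeasurableSet Gs → Gs ⊆ frontier D.carrier \ {D.pt 0} → (∀ z, wt z = Real.exp ((3 / 8 : ℝ) * limUnder (𝓝[D.carrier] z) (fun w => (L w).re))) → AEMeasurable wt (μ.restrict Gs) → AEMeasurable (fun z => (Φs z).re) (μ.restrict Gs) → 0 < c₀ → ν = MeasureTheory.Measure.map (fun z => (Φs z).re) ((μ.restrict Gs).withDensity fun z => ENNReal.ofReal (c₀ * wt z)) → (∀ w : ℂ, 0 < w.im → K w = g (Φ.symm w) * Complex.exp (-(5 / 8 : ℂ) * (L (Φ.symm w) - Lb))) → c ∈ frontier D.carrier → c ∉ Gs → innerNormal k' ≠ innerNormal k → innerNormal k' ≠ -innerNormal k → 0 < s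 → (D.carrier ∩ Metric.ball c s = halfPlane k c ∩ halfPlane k' c ∩ Metric.ball c s ∨ D.carrier ∩ Metric.ball c s = (halfPlane k c ∪ halfPlane k' c) ∩ Metric.ball c s) → D.pt 0 ∉ Metric.closedBall c s → ∃ (r γ β : ℝ), 0 < r ∧ 0 ≤ γ ∧ γ < 1 ∧ 0 ≤ β ∧ β < 1 ∧ MeasureTheory.IntegrableOn (fun w : ℂ => (‖w - (((Φs c).re : ℝ) : ℂ)‖ ^ γ : ℝ) * ‖K w‖) (Metric.ball (((Φs c).re : ℝ) : ℂ) r ∩ {w : ℂ | 0 < w.im}) ∧ ∫⁻ t in Set.Ioo ((Φs c).re - r) ((Φs c).re + r), ENNReal.ofReal (|t - (Φs c).re| ^ β) ∂ν < ⊤ :=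
  fun D Φ _Φs _L _Lb _g _μ _Gs _wt _c₀ _ν _K _c _k _k' _s hΦ0 hΦsc hΦse hΦsr hΦsi hL hexp hgi hμK hGm hGsub hwt
      hwtm hΦrm hc₀ hν hK hc hcG hk hk' hs hset h0 =>
    corner_bounds D Φ hΦ0 hΦsc hΦse hΦsr hΦsi hL hexp hgi hμK hGm hGsub hwt hwtm hΦrm hc₀ hν hK hc hcG hk hk'
      hs hset h0

end Transport

end Summit.CriticalPhenomena.SAWScalingLimit.Theorems.PolygonParitySqueeze
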